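import Summits.Ventures.WeilGRH.DualTrigKernelDefs
import HarnessLib

/-!
# Format D-K: the kernel checker, part 2 — cells, blocks, tail, the complete check

Cell `rh-explicit`, WEIL TRACK — GRH ARM, route B (weil-grh-3).  Continuation of
`DualTrigKernelDefs.lean` (data structures, claimed constants, terms): the per-cell lower bound
(`DKCert.cellLo` — rotation to the centre, Taylor moments, digamma bracket + explicit series terms,
interval Horner on integer sub-cells), the block/coverage conditions, the tail inequality and the
complete Boolean check `DKCert.check`.  See the module docstring of part 1 for the mathematics; the
soundness theorem is in `DualTrigKernelSound*.lean`.  Everything here is a DEFINITION (total,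
kernel-evaluable); no facts.

## References

* R. E. Moore, *Interval Analysis* (1966), Ch. 3–4 (interval extensions). [folklore]
-/

namespace Summit.Ventures.WeilGRH

open Literature.Analysis.ValidatedNumerics.NumericsMP

namespace DKCert

variable (c : DKCert)

/-! ### Cells -/

/-- Row width of the two-level phase table (short list walks in the kernel). [folklore] -/
def rowW : ℕ := 20

/-- The claimed table entry `i < Mc` of a block as a box. [folklore] -/
def tabEntry (b : DKBlock) (i : ℕ) : MC :=
  let e := (b.tab.getD (i / rowW) []).getD (i % rowW) (0, 0, 0, 0)
  ⟨⟨e.1, e.2.1⟩, ⟨e.2.2.1, e.2.2.2⟩⟩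

/-- `e^{iπ i/Mc}` for `i < 2 Mc` from the half table (negation for `i ≥ Mc`). [folklore] -/
def tabGet (b : DKBlock) (i : ℕ) : MC :=
  if i < b.Mc then tabEntry b i else (tabEntry b (i - b.Mc)).neg

/-- The claimed table of a block contains the engine's enclosures of `e^{iπ i/Mc}`, `i < Mc`, and has
the right shape. [folklore] -/
def tabOK (b : DKBlock) : Bool :=
  (List.range b.Mc).all fun i =>
    match MC.expI c.S c.Kser c.kexp c.piI ((c.piI.mulInt i).divNat b.Mc) with
    | some Z => encl (tabEntry b i).re Z.re && encl (tabEntry b i).im Z.im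
    | none => false

/-- Centre phase `(cos κθ_c, sin κθ_c)`, `θ_c = (2j+1)π/Mc`, of a term on cell `j` of block `b`.
[folklore] -/
def phase (b : DKBlock) (j : ℤ) (t : GTerm) : Option MC :=
  if t.isInt then
    some (tabGet b (((t.k : ℤ) * (2 * j + 1)) % (2 * (b.Mc : ℤ))).toNat)
  else
    MC.expI c.S c.Kser c.kexp c.piI (MI.mul c.S t.rI ((c.piI.mulInt (2 * j + 1)).divNat b.Mc))

/-- `|x| ≤ absUp I` as a thin interval, for `x ∈ I`. [folklore] -/
def absUp (I : MI) : MI := ⟨I.absHi, I.absHi⟩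

/-- The Taylor remainder bound of a term on a block, `(|A|+|B|)·((|κ| η⁺)^{2R}/(2R)! + (|κ|η⁺)^{2R+1}/(2R+1)!)`
(cell-independent: the rotated coefficients satisfy `|U|, |V| ≤ |A| + |B|`). [folklore] -/
def remTerm (etaPow : List MI) (t : GTerm) : MI :=
  let ab := (absUp t.A).add (absUp t.B)
  (MI.mul c.S ab ((MI.mul c.S (absUp (t.kpow.getD (2 * c.R) dft)) (etaPow.getD (2 * c.R) dft)).divNat
      (2 * c.R).factorial)).add
    (MI.mul c.S ab ((MI.mul c.S (absUp (t.kpow.getD (2 * c.R + 1) dft)) (etaPow.getD (2 * c.R + 1) dft)).divNat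
      (2 * c.R + 1).factorial))

/-- The total remainder bound of a block (sum over all terms). [folklore] -/
def remBlock (etaPow : List MI) (ts : List GTerm) : MI :=
  (ts.map (c.remTerm etaPow)).foldr MI.add (MI.ofInt c.S 0)

/-- `W · κ^m`: exact integer power for integer frequencies, interval product otherwise. [folklore] -/
def mulPow (t : GTerm) (W : MI) (m : ℕ) : MI :=
  if t.isInt then W.mulInt (t.kpowZ.getD m 0) else MI.mul c.S W (t.kpow.getD m dft)

/-- Add the moments of one term (rotated coefficients `U`, `V`) to the accumulator `mom`
(`mom[m] += U κ^m` for even `m`, `V κ^m` for odd `m`, `m < 2R`). [folklore] -/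
def addTerm (t : GTerm) (U V : MI) (mom : List MI) : List MI :=
  (List.range (2 * c.R)).map fun m => (mom.getD m dft).add (c.mulPow t (if m % 2 = 0 then U else V) m)

/-- The rotated coefficients `U = A cos κθ_c + B sin κθ_c`, `V = B cos κθ_c − A sin κθ_c` (with a fast path
for `B = 0`). [folklore] -/
def rotUV (t : GTerm) (Z : MC) : MI × MI :=
  if t.B.lo = 0 ∧ t.B.hi = 0 then (MI.mul c.S t.A Z.re, (MI.mul c.S t.A Z.im).neg)
  else ((MI.mul c.S t.A Z.re).add (MI.mul c.S t.B Z.im), (MI.mul c.S t.B Z.re).sub (MI.mul c.S t.A Z.im))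

/-- Zero moments. [folklore] -/
def zeroMom : List MI := (List.range (2 * c.R)).map fun _ => MI.ofInt c.S 0

/-- Moments of a list of terms on a cell (`none` if a phase failed): the pair (all terms, NON-periodic
terms only); the periodic part is the difference. [folklore] -/
def moments (b : DKBlock) (j : ℤ) : List GTerm → Option (List MI × List MI)
  | [] => some (c.zeroMom, c.zeroMom)
  | t :: ts =>
    match moments b j ts with
    | none => none
    | some (accA, accN) =>
      match c.phase b j t with
      | none => none
      | some Z =>
        let UV := c.rotUV t Z
        some (c.addTerm t UV.1 UV.2 accA, if t.comm then accN else c.addTerm t UV.1 UV.2 accN)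

/-- The moments of the periodic part as the difference (all − non-periodic). [folklore] -/
def periodicMom (acc : List MI × List MI) : List MI :=
  (List.range (2 * c.R)).map fun m => (acc.1.getD m dft).sub (acc.2.getD m dft)

/-- Taylor coefficients `c_m = (−1)^{⌊m/2⌋} mom_m / m!`. [folklore] -/
def coeffs (mom : List MI) : List MI :=
  (List.range (2 * c.R)).map fun m =>
    let x := (mom.getD m dft).divNat m.factorial
    if (m / 2) % 2 = 0 then x else x.neg

/-- Product of an interval with the integer range `[a, a+1]` (hull of the two endpoint multiples).
[folklore] -/
def mulUnitRange (I : MI) (a : ℤ) : MI := (I.mulInt a).hull (I.mulInt (a + 1))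

/-- Interval Horner evaluation of `Σ_m cs[m] ψ^m` over `ψ ∈ [a, a+1]` (integer `a`). [folklore] -/
def hornerZ (cs : List MI) (a : ℤ) : MI :=
  cs.foldr (fun cm acc => (mulUnitRange acc a).add cm) (MI.ofInt c.S 0)

/-- Rescaled coefficients `cs[m] · (η⁺/nin)^m` (the substitution `φ = (η⁺/nin) ψ`). [folklore] -/
def scaleCoeffs (b : DKBlock) (cs : List MI) : List MI :=
  (List.range cs.length).map fun m =>
    ((cs.getD m dft).mulInt ((b.etaNum : ℤ) ^ m)).divNat ((b.nin * b.etaDen) ^ m)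

/-- Minimum of the Horner lower ends over the `2 nin` sub-cells `ψ ∈ [i − nin, i − nin + 1]`. [folklore] -/
def innerLo (b : DKBlock) (cs : List MI) : ℤ :=
  let cs' := scaleCoeffs b cs
  ((List.range (2 * b.nin)).map fun (i : ℕ) => (c.hornerZ cs' ((i : ℤ) - b.nin)).lo).foldr min
    ((c.hornerZ cs' (-(b.nin : ℤ))).lo)

/-- `f_m(Y) = Y²/(l(l²+Y²))`. [folklore] -/
def fTerm (l Y : MI) : Option MI := MI.divPos c.S (Y.sqr c.S) (MI.mul c.S l ((l.sqr c.S).add (Y.sqr c.S)))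

/-- `f_m'(Y) = 2lY/(l²+Y²)²`. [folklore] -/
def fDeriv (l Y : MI) : Option MI :=
  MI.divPos c.S ((MI.mul c.S l Y).mulInt 2) (((l.sqr c.S).add (Y.sqr c.S)).sqr c.S)

/-- The remainder constant `(l² + c² + 2|c|·Ymax)/(l(l²+c²)²)`. [folklore] -/
def fRem (l Y Ymax : MI) : Option MI :=
  MI.divPos c.S (((l.sqr c.S).add (Y.sqr c.S)).add ((MI.mul c.S (absUp Y) Ymax).mulInt 2))
    (MI.mul c.S l (((l.sqr c.S).add (Y.sqr c.S)).sqr c.S))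

/-- `l_m = m + σ'`. [folklore] -/
def lI (m : ℕ) : MI := MI.ofFrac c.S (4 * m + 1 + 2 * c.par) 4

/-- Sum over `m < M0` of an `Option MI`-valued function. [folklore] -/
def sumOpt (f : ℕ → Option MI) : ℕ → Option MI
  | 0 => some (MI.ofInt c.S 0)
  | m + 1 => match sumOpt f m, f m with
    | some s, some x => some (s.add x)
    | _, _ => none

/-- The digamma data of cell `j` of block `b`: `(BRlo, F0, F1, EF)` = a lower bound (thin) of
`BR` on the cell, `Σ_{m<M0} f_m(y_c)`, `ρ Σ f_m'(y_c)`, and the remainder `(ρη⁺)² Σ fRem`. [folklore] -/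
def digammaData (b : DKBlock) (j : ℤ) : Option (MI × MI × MI × MI) :=
  let S := c.S
  let thLo := (c.piI.mulInt (2 * j)).divNat b.Mc
  let thHi := (c.piI.mulInt (2 * j + 2)).divNat b.Mc
  let thC := (c.piI.mulInt (2 * j + 1)).divNat b.Mc
  let yLo := MI.mul S thLo c.rhoI
  let yHi := MI.mul S thHi c.rhoI
  let yC := MI.mul S thC c.rhoI
  let ytil : ℤ := if 0 ≤ yLo.lo then yLo.lo else if yHi.hi ≤ 0 then -yHi.hi else 0
  let ytI : MI := ⟨ytil, ytil⟩
  let etaI := MI.ofFrac S b.etaNum b.etaDen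
  let reta := MI.mul S c.rhoI etaI
  let Ymax := (absUp yC).add reta
  match MC.digammaBox S c.Kdig c.Jdig c.piI MC.bernoulliTable ⟨c.sigI, ytI⟩,
    c.sumOpt (fun m => c.fTerm (c.lI m) ytI) c.M0,
    c.sumOpt (fun m => c.fTerm (c.lI m) yC) c.M0,
    c.sumOpt (fun m => c.fDeriv (c.lI m) yC) c.M0,
    c.sumOpt (fun m => c.fRem (c.lI m) yC Ymax) c.M0 with
  | some Dg, some Ft, some F0, some F1, some F2 =>
    let brlo := (Dg.re.sub Ft).lo
    some (⟨brlo, brlo⟩, F0, MI.mul S c.rhoI F1, MI.mul S (reta.sqr S) F2)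
  | _, _, _, _, _ => none

/-- Powers of `η⁺` up to `2R+1`. [folklore] -/
def etaPow (b : DKBlock) : List MI := powList c.S (MI.ofFrac c.S b.etaNum b.etaDen) (2 * c.R + 1)

/-- Does cell `j` of block `b` carry period duty (its lower bound of the periodic part is checked
against `mT`)?  Exactly the cells that can contain a point of `[−π, π]`. [folklore] -/
def periodDuty (b : DKBlock) (j : ℤ) : Bool :=
  decide (2 * j ≤ (b.Mc : ℤ)) && decide (-(b.Mc : ℤ) ≤ 2 * j + 2)

/-- The two lower bounds of a cell (scaled by `S`): of the full inequality and of the periodic part;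
`none` if an enclosure failed.  `E` is the block's Taylor remainder bound. [folklore] -/
def cellLo (b : DKBlock) (ts : List GTerm) (E : MI) (j : ℤ) : Option (ℤ × ℤ) :=
  match c.moments b j ts, c.digammaData b j with
  | some acc, some (BR, F0, F1, EF) =>
    let cs := c.coeffs acc.1
    let cs' := match cs with
      | c0 :: c1 :: rest => (((c0.add BR).add F0).add c.constI) :: (c1.add F1) :: rest
      | other => other
    some (c.innerLo b cs' - E.hi - EF.hi, c.innerLo b (c.coeffs (c.periodicMom acc)) - E.hi)
  | _, _ => none

/-- **The cell check**: the full lower bound is `≥ 0` and, on cells with period duty, the periodic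
lower bound is `≥ mT`. [folklore] -/
def cellOK (b : DKBlock) (ts : List GTerm) (E : MI) (j : ℤ) : Bool :=
  match c.cellLo b ts E j with
  | some (lov, loT) => decide (0 ≤ lov) && (!periodDuty b j || decide (c.mT ≤ loT))
  | none => false

/-- Check the cells `j0 + i`, `i0 ≤ i < i0 + cnt`, of a block (for chunking into several theorems).
[folklore] -/
def blockRangeOK (b : DKBlock) (i0 cnt : ℕ) : Bool :=
  let ts := c.terms
  let E := c.remBlock (c.etaPow b) ts
  (List.range cnt).all fun i => c.cellOK b ts E (b.j0 + (i0 + i : ℕ))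

/-- All cells of all blocks. [folklore] -/
def cellsOK : Bool := c.blocks.all fun b => c.blockRangeOK b 0 b.n

/-! ### Block geometry, tail -/

/-- Shape conditions of the blocks: `Mc, n, nin ≥ 1`, `η⁺ ≥ π/Mc` (via `piI.hi`), the claimed table, contiguity
`end_b ≥ start_{b+1}`, the first block starts at `θ ≤ 0` (at `j0 = 0` in the even case... i.e. `j0 ≤ 0`),
and the covered range contains a period (`[0, π]` resp. `[−π, π]`). [folklore] -/
def blocksOK : Bool :=
  let bs := c.blocks
  (bs.all fun b => decide (1 ≤ b.Mc) && decide (1 ≤ b.n) && decide (1 ≤ b.nin) && decide (1 ≤ b.etaDen) &&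
      decide (c.piI.hi * (b.etaDen : ℤ) ≤ (b.etaNum : ℤ) * c.S * b.Mc) && c.tabOK b) &&
  ((bs.zip bs.tail).all fun p =>
      decide (p.2.j0 * (p.1.Mc : ℤ) ≤ (p.1.j0 + p.1.n) * (p.2.Mc : ℤ))) &&
  (match bs.head?, bs.getLast? with
    | some b0, some bl =>
      (if c.even then decide (b0.j0 ≤ 0) else decide (2 * b0.j0 ≤ -(b0.Mc : ℤ))) &&
      decide ((bl.Mc : ℤ) ≤ 2 * (bl.j0 + bl.n))
    | _, _ => false)

/-- Lower bound (scaled) of `Re ψ(σ' + iy)` for `|y| ≥ |θ| ρ`, `θ = 2π jj / Mc`, via the thin box at a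
rational `ỹ ≤ |θ| ρ`. [folklore] -/
def psiTailLo (Mc : ℕ) (jj : ℤ) : Option ℤ :=
  let th := (c.piI.mulInt (2 * |jj|)).divNat Mc
  let y := MI.mul c.S th c.rhoI
  let yt : ℤ := max 0 y.lo
  match MC.digammaBox c.S c.Kdig c.Jdig c.piI MC.bernoulliTable ⟨c.sigI, ⟨yt, yt⟩⟩ with
  | some Dg => some Dg.re.lo
  | none => none

/-- `Σ (|A| + |B|)` (scaled) over the incommensurable window terms. [folklore] -/
def bInc : ℤ := ((c.terms.filter fun t => !t.comm).map fun t => t.A.absHi + t.B.absHi).sum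

/-- **The tail check**: at both ends of the covered range,
`Re ψ(σ'+iỹ) + (log q − log π) − B_inc + mT ≥ 0`. [folklore] -/
def tailOK : Bool :=
  match c.blocks.head?, c.blocks.getLast? with
  | some b0, some bl =>
    let ok (Mc : ℕ) (jj : ℤ) : Bool :=
      match c.psiTailLo Mc jj with
      | some v => decide (0 ≤ v + c.constI.lo - c.bInc + c.mT)
      | none => false
    ok bl.Mc (bl.j0 + bl.n) && (c.even || ok b0.Mc b0.j0)
  | _, _ => false

/-- Admissibility of the atoms for the window: `k ω ≥ log (N+1)`, i.e. `p0^k ≥ (N+1)^D`. [folklore] -/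
def atomsOK : Bool := c.atoms.all fun atm => decide ((c.N + 1) ^ c.D ≤ c.p0 ^ atm.k)

/-- The listed window values have pairwise distinct `n`. [folklore] -/
def valsNodup : Bool := decide ((c.vals.map (·.n)).Nodup)

/-- **The complete check** except the cells (which are chunked): constants, window data, blocks,
atoms, tail. [folklore] -/
def frameOK : Bool := c.constsOK && c.valsOK && c.valsNodup && c.blocksOK && c.atomsOK && c.tailOK

/-- **The complete check.** [folklore] -/
def check : Bool := c.frameOK && c.cellsOK

end DKCert

end Summit.Ventures.WeilGRH
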